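import Literature.NumberTheory.EllipticCurves.Kato2004.BigImageDivisibilityCyclotomicPrime
import Literature.NumberTheory.EllipticCurves.KatoDivisibilityAllPrimes
import HarnessLib

/-!
# Kato 2004, Thm. 17.4 (1)(2) at `p = 2` (no image hypothesis, `⊗ℚ`), read over `K = ℚ(ζ₄) = ℚ(i)`:
# `X(E/ℚ(ζ_{2^∞}))` is `Λ(Γ_K)`-torsion and `char_{Λ(Γ_K)} X(E/ℚ(ζ_{2^∞})) ∋ 2ⁿ · L₂(E,T) · L₂(E,ω,T)`
# (BOTH branches of the Mazur–Swinnerton-Dyer measure at `2`, `ω = χ₋₄`)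

Source: K. Kato, *`p`-adic Hodge theory and values of zeta functions of modular forms*, Astérisque **295**
(2004) 117–290 [Kato2004Asterisque], **Theorem 17.4 (1)(2)** (p. 273; held copy `paper:doi-10-24033-ast-639`,
PDF page = printed page − 115, p0158 L27–34), with §17.3 (p. 273: `X(T)` "as a module over `Λ = O_λ⟦G_∞⟧`"),
§12.1 (pp. 219–220, p0104 L47–176, p0105 L4–9: `G_∞ = Gal(ℚ(ζ_{p^∞})/ℚ) ≅ ℤ_p^×`, `Δ ≅ ℤ/2` and `G¹_∞ =
{σ : κ(σ) ≡ 1 mod 4}` in the case `p = 2`, `Λ = O_L[Δ]⟦G¹_∞⟧`, "If `p = 2`, the canonical map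
`O_L⟦G_∞⟧ → ∏_{j∈ℤ/2} O_L⟦G_∞⟧_j` is injective and the cokernel is killed by `2`", (12.1.3) "`O_L⟦G_∞⟧ ⊗ ℚ` is
the product of the principal ideal domains `O_L⟦G_∞⟧_j ⊗ ℚ`", (12.1.4) "`Λ_𝔭` is a discrete valuation ring
except in the case `p = 2 ∈ 𝔭`"), Thm. 16.2 / Remark 16.3 (p. 269: `L_{p-adic,α,ω,γ}(f)`, its interpolation at
ALL characters of `G_∞` and its dependence on `(ω, γ)` through `F^×`-scalars) and 17.13 (pp. 279–280: the
proof, "exact upto `×2` in the case `p = 2`", harmless at `𝔭 ∌ 2`). ONE NAMED FACT (`def … : Prop`, nothing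
asserted, statement-only; D-0014/D-0026), written by the seat `bsd-2adic-addL2` (GEN 6) of the cell
`bsd-2adic` (HOME `run/shared/lean/pub/bsd-2adic/`, MEMO-5).

It is the `p = 2`, clause-(2) (rational, `∃ n`, NO image hypothesis, NO "good `ω, γ`") SIBLING of the
all-branches product reading `Kato2004.charIdeal_dvd_padicLFunction_cyclotomicPrime_of_surjective` (this
directory: Thm. 17.4 (3) for odd `p` over `K = ℚ(ζ_p)`, the `p − 1` branches multiplied together) — same
module, same dictionary, TWO branches instead of `p − 1`, `2ⁿ` instead of a unit because at `p = 2` print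
offers clause (2) only — and the over-`ℚ(i)` COMPANION of the tree's over-`ℚ_∞` reading of the same clauses
`kato_divisibility_allPrimes W 2` (`KatoDivisibilityAllPrimes.lean`; page-audited at `p = 2` by the cell,
`run/shared/lean/pub/bsd-2adic/audit/D-AUDIT-h17-Kato174-at-2.md` @ sheet h17, referee C PASS), whose
Table C (the print → tree dictionary at `p = 2`) this file re-uses row by row — with its TWO `p = 2`
subtleties ABSENT here: over `K = ℚ(i)` there is NO `Δ`-descent (`K_∞ = ℚ(ζ_{2^∞})` IS Kato's tower) and NO
archimedean strict/relaxed `2`-torsion (`ℚ(ζ_{2^∞})` is totally complex).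

## The printed statement (p0158 L27–34, OCR-cleaned; read on the page)

"Theorem 17.4. — Assume `f` has good ordinary reduction at `λ`. Let `T` be a `Gal(ℚ̄/ℚ)`-stable
`O_λ`-lattice of `V_{F_λ}(f)`. (1) `X(T)` is a torsion `Λ`-module. (2) Let `α` be as in 17.1, let `ω` be a
non-zero element of `S(f*)`, and let `γ` be an element of `V_F(f*)` such that `γ⁺ ≠ 0` and `γ⁻ ≠ 0`. Then
`L_{p-adic,α,ω,γ}(f) ∈ Λ ⊗ ℚ`, and we have `length_{Λ_𝔭}(X(T)_𝔭) ≤ ord_𝔭(L_{p-adic,α,ω,γ}(f))` for any prime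
ideal `𝔭` in `Λ` of height one which does not contain `p`." The parity words of §17 are all in clause (3)
("Assume further `p ≠ 2` …", p0158 L37) — h17 sheet §0/Table B; Kato's Introduction prints the shape used
here: "(4) (Thm. 17.4) Assume `f` is good ordinary at `p`. Then `X` … and the characteristic ideal of `X`
divides `pⁿ` times the `p`-adic zeta function of `f` for some `n ≥ 0`" (p0004 L26–35, p. 119).

## The reading (each step = a row of the h17 sheet's Table A/C, or the product step of the odd sibling)

For `E/ℚ` with good ordinary reduction at `2` (17.1 (i): `2 ∤ N`, `a₂ ∈ ℤ₂^×`, i.e. `a₂` odd; tree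
`IsOrdinaryAt V 2`), `O_λ = ℤ₂`, `T = T₂E(−1)` (one lattice of print's "any": weaker), `X(T)` = the
Pontryagin dual of `Sel_{2^∞}(E/ℚ(ζ_{2^∞}))(−1)` (§17.3, §14.1; sheet Table A row d, Table C row C4) as a
module over `Λ = ℤ₂⟦G_∞⟧ = Λ₀[Δ]`, `Λ₀ := ℤ₂⟦G¹_∞⟧ ≅ ℤ₂⟦T⟧` (12.1). **Take `K := ℚ(ζ₄) = ℚ(i)`** (`d_K = −4`):
`K` is the fixed field of `G¹_∞ = {κ ≡ 1 mod 4}`, the fields `ℚ(ζ_{2^{n+2}})` are exactly the layers of the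
cyclotomic `ℤ₂`-extension `K_∞ = K·ℚ_∞ = ℚ(ζ_{2^∞})` of the NUMBER FIELD `K`, and `Γ_K := Gal(K_∞/K) = G¹_∞`
ON THE NOSE; so `X(E/K_∞)`, the dual of the classical `Sel_{2^∞}(E/K_∞)` as a `Λ(Γ_K) = Λ₀`-module with
`T = γ − 1`, `χ₂(γ) = 5 = 1 + 2^{e₀}` (`cyclotomicGenerator 2`; `5` topologically generates `1 + 4ℤ₂`;
sheet row i / C6), IS the tree's `WeierstrassCurve.SelmerDualData` of (any `K`-model `V'` of) `E_K` for
`κ : ZpExtension K 2` cyclotomic — and it is Kato's `X(T)` with the SCALARS RESTRICTED from `Λ` to `Λ₀`,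
up to the Tate twist `(1)` and the inversion convention, which are automorphisms of `Λ` over `ℤ₂`
preserving `Λ₀`, the set of height-one primes not containing `2` and (applied to both members of the pair
`(X, L)`) the printed inequalities (sheet C4; the ideals of BOTH branch functions below are stable under
`T ↦ (1+T)⁻¹ − 1` by the functional equation of Mazur–Tate–Teitelbaum §I.17 for the REAL characters `1`
and `ω = χ₋₄`, `PAdicBSD.lean` design note). Local conditions: Kato's `Sel` is Bloch–Kato's at every place
of the (totally complex) fields `ℚ(ζ_{2^n})` (14.1, p0119 L44–49), `=` the Greenberg/Kummer condition at the
unique prime above `2` of the ordinary cyclotomic tower (17.10 (17.10.1), p0162 L12–14; sheet C2) and the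
Kummer condition at `v ∤ 2` — the tree's `selmerInfty κ` over `K_∞` (archimedean conjuncts vacuous:
`H¹(ℂ, ·) = 0`; NO strict/relaxed defect, contrast sheet C3 over the totally real `ℚ_∞`).
(1) ⟹ `X` is `Λ₀`-torsion (`Λ` is free of rank `2` over the domain `Λ₀`; Table A row e: at `p = 2` print's
"torsion" means killed by a non-zero-divisor (15.1 gloss, p0136 L10), whose `Λ[1/2] = Λ₀[1/2] × Λ₀[1/2]`-
components are non-zero, whence a non-zero element of `Λ₀` killing `X`). (2): the height-one primes `𝔭 ∌ 2`
of `Λ` are the height-one primes of the two PIDs `Λ_j[1/2] = e_jΛ[1/2]`, `j ∈ ℤ/2` ((12.1.3)–(12.1.4);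
sheet Table B row B8, Table A row h), `X(T)_𝔭 = (e_jX[1/2])_𝔭`, and `X[1/2] = e₀X[1/2] ⊕ e₁X[1/2]` as a
`Λ₀[1/2]`-module; so the printed inequality at EVERY such `𝔭` says `char_{Λ₀[1/2]}(e_jX[1/2]) ∣ e_jL` for
BOTH `j`, whence — characteristic ideals being multiplicative along the direct sum —
`char_{Λ₀[1/2]}(X[1/2]) ∣ e₀L · e₁L`, i.e. (`char_{Λ₀}` commutes with `[1/2]`; `2`-powers and units absorbed)
`∃ n, 2ⁿ · e₀L · e₁L ∈ ι(char_{Λ₀} X)` — the SAME commutative algebra as sheet row h ("pure commutative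
algebra, parity-free") done on two components, = the product step of the odd sibling with `p − 1 = 2`…
except that at `p = 2` the components exist only after `⊗ℚ` (12.1: cokernel killed by `2`), which is exactly
why print (and this fact) stop at clause (2). The two components of Kato's `L_{p-adic,α,ω,γ}(f)` (16.2:
interpolation at all finite-order characters `χ` of `G_∞`, `± = (−1)^{…}χ(−1)`, periods `per(ω,γ) =
Ω₊γ⁺ + Ω₋γ⁻`; 16.3 (2): any two `(ω, γ)` differ by `F^× = ℚ^×` scalars — units of `Λ₀[1/2]` up to `2`-powers,
invisible to clause (2); sheet C5) are, up to such scalars, the EVEN branch `L₂(E,T) = ∫_{ℤ₂^×}(1+T)^{ℓ(x)}dμ⁺`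
(characters trivial on `Δ`; Mazur–Tate–Teitelbaum §I.13 on the PLUS modular symbols; tree `padicLFunction f α`,
variable `1 + T ↔ 5`) and the ODD branch `L₂(E,ω,T) = ∫_{ℤ₂^×} ω(x)(1+T)^{ℓ(x)}dμ⁻` (`ω = χ₋₄`, the character
of `Δ`; MTT §I.13 on the MINUS symbols; tree `padicLFunctionMinusBranch f α 1`, SAME variable). Conclusion
transcribed: `X(E/K_∞)` is `Λ`-torsion and `2ⁿ · L₂(E,T) · L₂(E,ω,T) = ι g` for some `n` and some
`g ∈ char_{Λ(Γ_K)} X(E/K_∞)`.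

Hypotheses transcribed: `E = V` globally minimal over `ℚ`, `IsOrdinaryAt V 2`; `K` a number field with
`[K:ℚ] = 2`, `d_K = −4` (`= ℚ(i) = ℚ(ζ₄)`); `V'` any `K`-model of `E_K` (`C • V.baseChange K = V'`; the
Selmer group is a `K`-isomorphism invariant); `κ` the cyclotomic `ℤ₂`-extension of `K` with topological
generator `γ` normalised by `χ₂(γ) = 5` EXACTLY (`χ₂(Γ_K) = 1 + 4ℤ₂` is torsion-free, so no Teichmüller
ambiguity; twin of the tree's `IsCyclotomicVariable 2 γ` over `ℚ`); `f` the newform of `E`, `α = unitRoot V 2`;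
`D` a Pontryagin-dual datum of `Sel_{2^∞}(E/K_∞)`. WEAKER than print (`K = ℚ(ζ₄)` and the `Λ₀`-structure only;
one lattice; the `∃ n` form), never stronger; no CM exclusion (print has none: §15 via Rubin, sheet §6).
What is NOT here: `K = ℚ(√−2)` (same tower `ℚ(ζ_{2^∞})`, `Γ_K = ⟨(−1,5)⟩`: the odd component is then read in
the variable `1 + T ↦ −(1+T)`, i.e. `L₂(E,ω,−2−T)` — a separate fact if wanted); clause (3) (print: `p ≠ 2`);
multiplicative reduction at `2` (17.1 requires `p ∤ N`); weight `> 2`; any proof.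
-- TODO(general form): Thm. 17.4 (1)(2) as the `Λ(G_∞)`-statement for lattices `T ⊂ V_{F_λ}(f)` of any
-- ordinary newform `f`, all `p` (the tree has no `Λ(G_∞)`-module structure on Selmer duals).

Consumer: the cell's `K*`-road for ADDITIVE reduction at `2` (`Summits/…/Rank1Residual/X5/TwoAdicAdditiveL2Cyc.lean`
typed input (I-K*) `CycMainConjectureOverKAtTwo`, generator `cycGeneratorQi f α = L⁺·L⁻_ω`): for an additive
`E` with semistable twist `E' = E^{(−1)}` good ordinary at `2`, `E_{ℚ(i)} ≅ E'_{ℚ(i)}` and this fact (for `E'`)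
is the divisibility half of (I-K*) — replacing the memo-grade "Kato on the `χ₋₄`-branch for the additive `E`
over `ℚ_∞`" (which needed a twist dictionary) and the memo-grade gluing lemma. No `_holds` is to be expected.
-/

noncomputable section

open scoped Classical MatrixGroups ModularForm

open CongruenceSubgroup WeierstrassCurve Literature.NumberTheory.EllipticCurves
  Literature.NumberTheory.EllipticCurves.ModularForms
  Literature.NumberTheory.GaloisRepresentations

namespace Literature.NumberTheory.EllipticCurves.Kato2004

/-- **Kato 2004, Theorem 17.4 (1)(2) at `p = 2`, read over `K = ℚ(ζ₄) = ℚ(i)`: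
`char_{Λ(Γ_K)} X(E/ℚ(ζ_{2^∞})) ∋ 2ⁿ · L₂(E,T) · L₂(E,ω,T)`.** As printed (Astérisque 295, Thm. 17.4, p. 273):
"Assume `f` has good ordinary reduction at `λ`. Let `T` be a `Gal(ℚ̄/ℚ)`-stable `O_λ`-lattice of `V_{F_λ}(f)`.
(1) `X(T)` is a torsion `Λ`-module. (2) Let `α` be as in 17.1, let `ω` be a non-zero element of `S(f*)`, and
let `γ` be an element of `V_F(f*)` such that `γ⁺ ≠ 0` and `γ⁻ ≠ 0`. Then `L_{p-adic,α,ω,γ}(f) ∈ Λ ⊗ ℚ`, and we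
have `length_{Λ_𝔭}(X(T)_𝔭) ≤ ord_𝔭(L_{p-adic,α,ω,γ}(f))` for any prime ideal `𝔭` in `Λ` of height one which
does not contain `p`" — `Λ = O_λ⟦Gal(ℚ(ζ_{p^∞})/ℚ)⟧ = O_λ[Δ]⟦G¹_∞⟧` (§12.1, §17.3), at `p = 2`: `Δ ≅ ℤ/2`,
`G¹_∞ = {κ ≡ 1 mod 4}`, "`Λ ⊗ ℚ` is the product of the principal ideal domains `Λ_j ⊗ ℚ`" (12.1.3). For
`E/ℚ` good ordinary at `2`, `T = T₂E(−1)`: `G¹_∞ = Gal(ℚ(ζ_{2^∞})/ℚ(ζ₄)) = Γ_K` for `K = ℚ(i)`, whose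
cyclotomic `ℤ₂`-extension IS `ℚ(ζ_{2^∞})`, so `X(T)` with scalars restricted to `Λ(Γ_K)` is the tree's
Iwasawa module of (any `K`-model `V'` of) `E_K` for `κ : ZpExtension K 2` cyclotomic, `T = γ − 1`,
`χ₂(γ) = 5` (module docstring: the Tate twist and the local conditions as in the cell's h17 sheet, Table
C, with NO `Δ`-descent and NO archimedean defect over the totally complex `ℚ(ζ_{2^∞})`); the printed
inequality at every height-one `𝔭 ∌ 2`, i.e. at every height-one prime of BOTH components `Λ_j[1/2]`,
gives `char(e_jX[1/2]) ∣ e_jL` for `j = 0, 1`, whence `∃ n, 2ⁿ·e₀L·e₁L ∈ ι(char_{Λ(Γ_K)} X)`, the two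
components of the Mazur–Swinnerton-Dyer measure (Thm. 16.2; 16.3 (2): `ℚ^×`-scalars, invisible here) being
the even branch `L₂(E,T)` (tree `padicLFunction f α`, MTT §I.13 on `[·]⁺`) and the odd branch
`L₂(E,ω,T)`, `ω = χ₋₄` (tree `padicLFunctionMinusBranch f α 1`, MTT §I.13 on `[·]⁻`), same variable
`1 + T ↔ 5`. Hypotheses: `V` globally minimal, `IsOrdinaryAt V 2`; `[K:ℚ] = 2`, `d_K = −4`;
`C • V.baseChange K = V'`; `κ` cyclotomic, `κ γ = 1`, `χ₂(γ) = 5`; `f` the newform of `V`,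
`α = unitRoot V 2`; `D` any dual datum. Conclusion: `D.IsTorsion ∧ ∃ n g, g ∈ D.charIdeal ∧
ι g = 2ⁿ·(padicLFunction f α · padicLFunctionMinusBranch f α 1)`. The clause-(2), `p = 2` sibling of
`charIdeal_dvd_padicLFunction_cyclotomicPrime_of_surjective`; the over-`ℚ(i)` companion of
`kato_divisibility_allPrimes W 2`. Weaker than print; named fact, nothing asserted.
[cite: Kato2004Asterisque, Thm. 17.4 (1)(2) (p. 273) with §17.3 (p. 273), §12.1 (12.1.3)–(12.1.4) (pp. 219–220), Thm. 16.2 / Rem. 16.3 (p. 269), 17.10 (p. 277), 17.13 (pp. 279–280), Introduction (4) (p. 119)]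
[cite: MazurTateTeitelbaum1986Invent, §I.13 and §I.17] -/
def charIdeal_dvd_padicLFunction_cyclotomicFour_two : Prop :=
  ∀ (V : WeierstrassCurve ℚ) [V.IsElliptic] [V.IsGloballyMinimal]
    (K : Type) [Field K] [NumberField K] (V' : WeierstrassCurve K) [V'.IsElliptic]
    {κ : ZpExtension K 2} {γ : Field.absoluteGaloisGroup K} {N : ℕ} [NeZero N]
    {f : CuspForm (Gamma0 N) 2},
    IsOrdinaryAt V 2 → Module.finrank ℚ K = 2 → NumberField.discr K = -4 →
    (∃ C : VariableChange K, C • V.baseChange K = V') →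
    κ.IsCyclotomic → κ.IsTopGenerator γ →
    ((GaloisRep.cyclotomicCharacter K 2 γ : ℤ_[2]ˣ) : ℤ_[2]) = ((cyclotomicGenerator 2 : ℕ) : ℤ_[2]) →
    IsNewformOf V f →
    ∀ (D : V'.SelmerDualData κ γ),
      D.IsTorsion ∧
      ∃ (n : ℕ) (g : IwasawaAlgebra 2), g ∈ D.charIdeal ∧
        iwasawaToPowerSeries 2 g =
          PowerSeries.C ((2 : ℚ_[2]) ^ n) *
            (padicLFunction f ((unitRoot V 2 : ℤ_[2]) : ℚ_[2]) *
              padicLFunctionMinusBranch f ((unitRoot V 2 : ℤ_[2]) : ℚ_[2]) 1)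

end Literature.NumberTheory.EllipticCurves.Kato2004

end
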